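import Summits.ResolutionOfSingularities.ResolutionOfSingularities.Theorems.FrobeniusLadderFRationalModificationCover
import HarnessLib

/-!
# Crux `FRationalModification` — the certified-cover form IS the crux (line `Sketch`, skeleton v7)

Companion of `FrobeniusLadderFRationalModificationCover.lean` (crux stmt-ResolutionOfSingularities-15316,
`Summit.ResolutionOfSingularities.ResolutionOfSingularities.Theses.FrobeniusLadder.FRationalModification`,
line `Sketch`, lead cycle 3). That file proves the crux FROM the certified-cover form (the open stub
`stub_cover` of skeleton v7 as a hypothesis). This file proves the converse and the consistency
remarks:

* §3 `cover_of_rungThreeModel`, `cover_of_fRationalModification`, `fRationalModification_iff_cover`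
  — a rung-3 model is a certified cover (`W = Y₂`, `h = 𝟙`), so the crux implies the cover form
  outright (through `IntegralForm.fRationalModification_iff_integral`, p131587): THE OPEN STUB OF v7 IS
  THE CRUX, in the geometry the construction frames deliver (a modification plus a finite flat chart
  scheme, certified pointwise by tight closure upstairs or by a Cohen–Macaulay F-injective divisor).
* §4 `cover_of_hasResolution`, `cover_of_dim_le_one` — consistency with the summit (a resolution is a
  certified cover: regular stalks are rung-3, support item `RegularStalksClimb`) and the unconditional
  dimension-`≤ 1` case (normalisation, tree `hasResolution_of_dim_le_one`).

No definition is declared; every statement is written inline in the route file's vocabulary.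
-/

-- single-problem summit: the doubled namespace component `ResolutionOfSingularities` is forced
set_option linter.dupNamespace false

noncomputable section

open CategoryTheory AlgebraicGeometry TopologicalSpace IsLocalRing RingTheory.Sequence
open Literature.RingTheory.TightClosure Literature.AlgebraicGeometry.Resolution
open Summit.ResolutionOfSingularities.ResolutionOfSingularities.Theses.FrobeniusLadder
open Summit.ResolutionOfSingularities.ResolutionOfSingularities.Theorems.FRationalModification

namespace Summit.ResolutionOfSingularities.ResolutionOfSingularities.Theorems.FRationalModification.Cover

/-! ## §3 Conversely: rung-3 models are certified covers; the cover form IS the crux -/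

/-- **A rung-3 model is a certified cover** (`W = Y₂`, `h = 𝟙`, rung-3 branch at `w = x`).
[folklore] -/
theorem cover_of_rungThreeModel (p : ℕ) {Y : Scheme.{0}}
    (h : ∃ (Y₂ : Scheme.{0}) (π : Y₂ ⟶ Y), IsProper π ∧ IsBirational π ∧ ∀ x : Y₂,
      IsDomain (Y₂.presheaf.stalk x) ∧ ∀ d : ℕ, ringKrullDim (Y₂.presheaf.stalk x) = d →
          ∀ s : Fin d → Y₂.presheaf.stalk x, (Ideal.span (Set.range s)).radical.IsMaximal →
            ∀ y c : Y₂.presheaf.stalk x, c ≠ 0 →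
              (∀ e : ℕ, c * y ^ p ^ e ∈
                Ideal.span ((fun z : Y₂.presheaf.stalk x => z ^ p ^ e) ''
                  (Ideal.span (Set.range s) : Set (Y₂.presheaf.stalk x)))) →
              y ∈ Ideal.span (Set.range s)) :
    ∃ (Y₂ : Scheme.{0}) (π : Y₂ ⟶ Y), IsProper π ∧ IsBirational π ∧
      ∃ (W : Scheme.{0}) (h : W ⟶ Y₂), IsFinite h ∧ Flat h ∧
        ∀ x : Y₂, ∃ w : W, h.base w = x ∧
          ((IsDomain (W.presheaf.stalk w) ∧
              ∀ d : ℕ, ringKrullDim (W.presheaf.stalk w) = d → ∀ s : Fin d → W.presheaf.stalk w,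
                (Ideal.span (Set.range s)).radical.IsMaximal → ∀ y c : W.presheaf.stalk w, c ≠ 0 →
                  (∀ e : ℕ, c * y ^ p ^ e ∈
                    Ideal.span ((fun z : W.presheaf.stalk w => z ^ p ^ e) ''
                      (Ideal.span (Set.range s) : Set (W.presheaf.stalk w)))) →
                  y ∈ Ideal.span (Set.range s)) ∨
            (IsDomain (W.presheaf.stalk w) ∧ ∃ g : W.presheaf.stalk w,
              g ∈ maximalIdeal (W.presheaf.stalk w) ∧ g ≠ 0 ∧
              (∀ d : ℕ, ringKrullDim (W.presheaf.stalk w ⧸ Ideal.span {g}) = d →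
                ∀ t : Fin d → W.presheaf.stalk w ⧸ Ideal.span {g},
                  (Ideal.span (Set.range t)).radical.IsMaximal →
                    RingTheory.Sequence.IsWeaklyRegular (W.presheaf.stalk w ⧸ Ideal.span {g})
                      (List.ofFn t) ∧
                    ∀ y : W.presheaf.stalk w ⧸ Ideal.span {g}, (∃ e : ℕ, y ^ p ^ e ∈
                      Ideal.span ((fun z : W.presheaf.stalk w ⧸ Ideal.span {g} => z ^ p ^ e) ''
                        (Ideal.span (Set.range t) : Set (W.presheaf.stalk w ⧸ Ideal.span {g})))) →
                      y ∈ Ideal.span (Set.range t)) ∧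
              ∃ n : ℕ, ∀ m : ℕ, ringKrullDim (W.presheaf.stalk w) = m →
                ∀ s : Fin m → W.presheaf.stalk w, (Ideal.span (Set.range s)).radical.IsMaximal →
                  ∀ y c : W.presheaf.stalk w, c ≠ 0 →
                    (∀ e : ℕ, c * y ^ p ^ e ∈
                      Ideal.span ((fun z : W.presheaf.stalk w => z ^ p ^ e) ''
                        (Ideal.span (Set.range s) : Set (W.presheaf.stalk w)))) →
                    g ^ n * y ∈ Ideal.span (Set.range s))) := by
  obtain ⟨Y₂, π, hπ, hbir, h3⟩ := h
  exact ⟨Y₂, π, hπ, hbir, Y₂, 𝟙 Y₂, inferInstance, inferInstance,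
    fun x => ⟨x, rfl, Or.inl (h3 x)⟩⟩

/-- **The crux implies the cover form** at every prime `p`: by the integral form of the crux
(`IntegralForm.fRationalModification_iff_integral`, p131587) an integral rung-2 `Y/k` has a rung-3
proper birational model, which is a certified cover (`cover_of_rungThreeModel`). [folklore] -/
theorem cover_of_fRationalModification (hcrux : FRationalModification) (p : ℕ) [Fact p.Prime] :
    ∀ (k : Type) [Field k] [CharP k p] (Y : Scheme.{0}) (g : Y ⟶ Spec (.of k)),
      IsSeparated g → LocallyOfFiniteType g → QuasiCompact g → IsIntegral Y →
      (∀ y : Y, IsDomain (Y.presheaf.stalk y) ∧ ∀ d : ℕ, ringKrullDim (Y.presheaf.stalk y) = d →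
      ∀ s : Fin d → Y.presheaf.stalk y, (Ideal.span (Set.range s)).radical.IsMaximal →
        RingTheory.Sequence.IsWeaklyRegular (Y.presheaf.stalk y) (List.ofFn s) ∧
        ∀ w : Y.presheaf.stalk y, (∃ e : ℕ, w ^ p ^ e ∈
          Ideal.span ((fun z : Y.presheaf.stalk y => z ^ p ^ e) ''
            (Ideal.span (Set.range s) : Set (Y.presheaf.stalk y)))) →
          w ∈ Ideal.span (Set.range s)) →
      ∃ (Y₂ : Scheme.{0}) (π : Y₂ ⟶ Y), IsProper π ∧ IsBirational π ∧
        ∃ (W : Scheme.{0}) (h : W ⟶ Y₂), IsFinite h ∧ Flat h ∧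
        ∀ x : Y₂, ∃ w : W, h.base w = x ∧
          ((IsDomain (W.presheaf.stalk w) ∧
              ∀ d : ℕ, ringKrullDim (W.presheaf.stalk w) = d → ∀ s : Fin d → W.presheaf.stalk w,
                (Ideal.span (Set.range s)).radical.IsMaximal → ∀ y c : W.presheaf.stalk w, c ≠ 0 →
                  (∀ e : ℕ, c * y ^ p ^ e ∈
                    Ideal.span ((fun z : W.presheaf.stalk w => z ^ p ^ e) ''
                      (Ideal.span (Set.range s) : Set (W.presheaf.stalk w)))) →
                  y ∈ Ideal.span (Set.range s)) ∨
            (IsDomain (W.presheaf.stalk w) ∧ ∃ g : W.presheaf.stalk w,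
              g ∈ maximalIdeal (W.presheaf.stalk w) ∧ g ≠ 0 ∧
              (∀ d : ℕ, ringKrullDim (W.presheaf.stalk w ⧸ Ideal.span {g}) = d →
                ∀ t : Fin d → W.presheaf.stalk w ⧸ Ideal.span {g},
                  (Ideal.span (Set.range t)).radical.IsMaximal →
                    RingTheory.Sequence.IsWeaklyRegular (W.presheaf.stalk w ⧸ Ideal.span {g})
                      (List.ofFn t) ∧
                    ∀ y : W.presheaf.stalk w ⧸ Ideal.span {g}, (∃ e : ℕ, y ^ p ^ e ∈
                      Ideal.span ((fun z : W.presheaf.stalk w ⧸ Ideal.span {g} => z ^ p ^ e) ''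
                        (Ideal.span (Set.range t) : Set (W.presheaf.stalk w ⧸ Ideal.span {g})))) →
                      y ∈ Ideal.span (Set.range t)) ∧
              ∃ n : ℕ, ∀ m : ℕ, ringKrullDim (W.presheaf.stalk w) = m →
                ∀ s : Fin m → W.presheaf.stalk w, (Ideal.span (Set.range s)).radical.IsMaximal →
                  ∀ y c : W.presheaf.stalk w, c ≠ 0 →
                    (∀ e : ℕ, c * y ^ p ^ e ∈
                      Ideal.span ((fun z : W.presheaf.stalk w => z ^ p ^ e) ''
                        (Ideal.span (Set.range s) : Set (W.presheaf.stalk w)))) →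
                    g ^ n * y ∈ Ideal.span (Set.range s))) := by
  intro k _ _ Y g hs hl hq hY h₂
  exact cover_of_rungThreeModel p
    (IntegralForm.fRationalModification_iff_integral.mp hcrux p Fact.out k Y g hs hl hq hY h₂)

/-- **THE OPEN STUB OF v7 IS THE CRUX**: `FRationalModification` is equivalent to its certified-cover
form (`fRationalModification_of_cover`, `cover_of_fRationalModification`). So line `Sketch` carries
no hidden reduction: what it leaves open is exactly the F-rationalification problem, now phrased in
the geometry the three construction frames deliver (a modification plus a finite flat chart scheme,
certified pointwise by tight closure upstairs or by a Cohen–Macaulay F-injective divisor).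
[folklore] -/
theorem fRationalModification_iff_cover :
    FRationalModification ↔ ∀ (p : ℕ) [Fact p.Prime], ∀ (k : Type) [Field k] [CharP k p] (Y : Scheme.{0}) (g : Y ⟶ Spec (.of k)),
      IsSeparated g → LocallyOfFiniteType g → QuasiCompact g → IsIntegral Y →
      (∀ y : Y, IsDomain (Y.presheaf.stalk y) ∧ ∀ d : ℕ, ringKrullDim (Y.presheaf.stalk y) = d →
      ∀ s : Fin d → Y.presheaf.stalk y, (Ideal.span (Set.range s)).radical.IsMaximal →
        RingTheory.Sequence.IsWeaklyRegular (Y.presheaf.stalk y) (List.ofFn s) ∧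
        ∀ w : Y.presheaf.stalk y, (∃ e : ℕ, w ^ p ^ e ∈
          Ideal.span ((fun z : Y.presheaf.stalk y => z ^ p ^ e) ''
            (Ideal.span (Set.range s) : Set (Y.presheaf.stalk y)))) →
          w ∈ Ideal.span (Set.range s)) →
      ∃ (Y₂ : Scheme.{0}) (π : Y₂ ⟶ Y), IsProper π ∧ IsBirational π ∧
        ∃ (W : Scheme.{0}) (h : W ⟶ Y₂), IsFinite h ∧ Flat h ∧
        ∀ x : Y₂, ∃ w : W, h.base w = x ∧
          ((IsDomain (W.presheaf.stalk w) ∧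
              ∀ d : ℕ, ringKrullDim (W.presheaf.stalk w) = d → ∀ s : Fin d → W.presheaf.stalk w,
                (Ideal.span (Set.range s)).radical.IsMaximal → ∀ y c : W.presheaf.stalk w, c ≠ 0 →
                  (∀ e : ℕ, c * y ^ p ^ e ∈
                    Ideal.span ((fun z : W.presheaf.stalk w => z ^ p ^ e) ''
                      (Ideal.span (Set.range s) : Set (W.presheaf.stalk w)))) →
                  y ∈ Ideal.span (Set.range s)) ∨
            (IsDomain (W.presheaf.stalk w) ∧ ∃ g : W.presheaf.stalk w,
              g ∈ maximalIdeal (W.presheaf.stalk w) ∧ g ≠ 0 ∧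
              (∀ d : ℕ, ringKrullDim (W.presheaf.stalk w ⧸ Ideal.span {g}) = d →
                ∀ t : Fin d → W.presheaf.stalk w ⧸ Ideal.span {g},
                  (Ideal.span (Set.range t)).radical.IsMaximal →
                    RingTheory.Sequence.IsWeaklyRegular (W.presheaf.stalk w ⧸ Ideal.span {g})
                      (List.ofFn t) ∧
                    ∀ y : W.presheaf.stalk w ⧸ Ideal.span {g}, (∃ e : ℕ, y ^ p ^ e ∈
                      Ideal.span ((fun z : W.presheaf.stalk w ⧸ Ideal.span {g} => z ^ p ^ e) ''
                        (Ideal.span (Set.range t) : Set (W.presheaf.stalk w ⧸ Ideal.span {g})))) →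
                      y ∈ Ideal.span (Set.range t)) ∧
              ∃ n : ℕ, ∀ m : ℕ, ringKrullDim (W.presheaf.stalk w) = m →
                ∀ s : Fin m → W.presheaf.stalk w, (Ideal.span (Set.range s)).radical.IsMaximal →
                  ∀ y c : W.presheaf.stalk w, c ≠ 0 →
                    (∀ e : ℕ, c * y ^ p ^ e ∈
                      Ideal.span ((fun z : W.presheaf.stalk w => z ^ p ^ e) ''
                        (Ideal.span (Set.range s) : Set (W.presheaf.stalk w)))) →
                    g ^ n * y ∈ Ideal.span (Set.range s))) :=
  ⟨fun h p _ => cover_of_fRationalModification h p, fun h => fRationalModification_of_cover h⟩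

/-! ## §4 Consistency with the summit; the unconditional dimension-`≤ 1` case -/

/-- **A resolution of `Y` is a certified cover of `Y`** (`W = Y₂` the resolution, `h = 𝟙`, rung-3
branch: regular local rings of characteristic `p` are rung-3, `Negative.rungThree_of_isRegularLocalRing`
= support item `RegularStalksClimb`, Hochster–Huneke 4.4 via Kunz). So the open stub is implied by the
summit and cannot be refuted short of `¬ResolutionOfSingularities`. [folklore] -/
theorem cover_of_hasResolution (p : ℕ) [Fact p.Prime] (k : Type) [Field k] [CharP k p]
    (Y : Scheme.{0}) (g : Y ⟶ Spec (.of k)) [LocallyOfFiniteType g] (hres : Scheme.HasResolution Y) :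
    ∃ (Y₂ : Scheme.{0}) (π : Y₂ ⟶ Y), IsProper π ∧ IsBirational π ∧
      ∃ (W : Scheme.{0}) (h : W ⟶ Y₂), IsFinite h ∧ Flat h ∧
        ∀ x : Y₂, ∃ w : W, h.base w = x ∧
          ((IsDomain (W.presheaf.stalk w) ∧
              ∀ d : ℕ, ringKrullDim (W.presheaf.stalk w) = d → ∀ s : Fin d → W.presheaf.stalk w,
                (Ideal.span (Set.range s)).radical.IsMaximal → ∀ y c : W.presheaf.stalk w, c ≠ 0 →
                  (∀ e : ℕ, c * y ^ p ^ e ∈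
                    Ideal.span ((fun z : W.presheaf.stalk w => z ^ p ^ e) ''
                      (Ideal.span (Set.range s) : Set (W.presheaf.stalk w)))) →
                  y ∈ Ideal.span (Set.range s)) ∨
            (IsDomain (W.presheaf.stalk w) ∧ ∃ g : W.presheaf.stalk w,
              g ∈ maximalIdeal (W.presheaf.stalk w) ∧ g ≠ 0 ∧
              (∀ d : ℕ, ringKrullDim (W.presheaf.stalk w ⧸ Ideal.span {g}) = d →
                ∀ t : Fin d → W.presheaf.stalk w ⧸ Ideal.span {g},
                  (Ideal.span (Set.range t)).radical.IsMaximal →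
                    RingTheory.Sequence.IsWeaklyRegular (W.presheaf.stalk w ⧸ Ideal.span {g})
                      (List.ofFn t) ∧
                    ∀ y : W.presheaf.stalk w ⧸ Ideal.span {g}, (∃ e : ℕ, y ^ p ^ e ∈
                      Ideal.span ((fun z : W.presheaf.stalk w ⧸ Ideal.span {g} => z ^ p ^ e) ''
                        (Ideal.span (Set.range t) : Set (W.presheaf.stalk w ⧸ Ideal.span {g})))) →
                      y ∈ Ideal.span (Set.range t)) ∧
              ∃ n : ℕ, ∀ m : ℕ, ringKrullDim (W.presheaf.stalk w) = m →
                ∀ s : Fin m → W.presheaf.stalk w, (Ideal.span (Set.range s)).radical.IsMaximal →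
                  ∀ y c : W.presheaf.stalk w, c ≠ 0 →
                    (∀ e : ℕ, c * y ^ p ^ e ∈
                      Ideal.span ((fun z : W.presheaf.stalk w => z ^ p ^ e) ''
                        (Ideal.span (Set.range s) : Set (W.presheaf.stalk w)))) →
                    g ^ n * y ∈ Ideal.span (Set.range s))) := by
  refine cover_of_rungThreeModel p ?_
  obtain ⟨Y₂, π, hπ⟩ := hres
  haveI := hπ.isProper
  refine ⟨Y₂, π, hπ.isProper, hπ.isBirational, fun x => ?_⟩
  haveI : CharP (Y₂.presheaf.stalk x) p := Negative.charP_stalk (π ≫ g) x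
  exact Negative.rungThree_of_isRegularLocalRing (Fact.out : p.Prime) _ (hπ.isRegular x)

/-- **The cover form holds unconditionally in dimension `≤ 1`**: an integral `Y/k` of finite type
with `dim Y ≤ 1` is resolved by its normalisation (tree `hasResolution_of_dim_le_one`, no named fact),
and a resolution is a certified cover (`cover_of_hasResolution`). The rung-2 hypothesis is not used;
by Disproof §3 (`Negative.localRungClimb_false`) it could not replace the normalisation even here.
[folklore] -/
theorem cover_of_dim_le_one (p : ℕ) [Fact p.Prime] (k : Type) [Field k] [CharP k p]
    (Y : Scheme.{0}) (g : Y ⟶ Spec (.of k)) [LocallyOfFiniteType g] [QuasiCompact g] [IsIntegral Y]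
    (hdim : topologicalKrullDim Y ≤ 1) :
    ∃ (Y₂ : Scheme.{0}) (π : Y₂ ⟶ Y), IsProper π ∧ IsBirational π ∧
      ∃ (W : Scheme.{0}) (h : W ⟶ Y₂), IsFinite h ∧ Flat h ∧
        ∀ x : Y₂, ∃ w : W, h.base w = x ∧
          ((IsDomain (W.presheaf.stalk w) ∧
              ∀ d : ℕ, ringKrullDim (W.presheaf.stalk w) = d → ∀ s : Fin d → W.presheaf.stalk w,
                (Ideal.span (Set.range s)).radical.IsMaximal → ∀ y c : W.presheaf.stalk w, c ≠ 0 →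
                  (∀ e : ℕ, c * y ^ p ^ e ∈
                    Ideal.span ((fun z : W.presheaf.stalk w => z ^ p ^ e) ''
                      (Ideal.span (Set.range s) : Set (W.presheaf.stalk w)))) →
                  y ∈ Ideal.span (Set.range s)) ∨
            (IsDomain (W.presheaf.stalk w) ∧ ∃ g : W.presheaf.stalk w,
              g ∈ maximalIdeal (W.presheaf.stalk w) ∧ g ≠ 0 ∧
              (∀ d : ℕ, ringKrullDim (W.presheaf.stalk w ⧸ Ideal.span {g}) = d →
                ∀ t : Fin d → W.presheaf.stalk w ⧸ Ideal.span {g},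
                  (Ideal.span (Set.range t)).radical.IsMaximal →
                    RingTheory.Sequence.IsWeaklyRegular (W.presheaf.stalk w ⧸ Ideal.span {g})
                      (List.ofFn t) ∧
                    ∀ y : W.presheaf.stalk w ⧸ Ideal.span {g}, (∃ e : ℕ, y ^ p ^ e ∈
                      Ideal.span ((fun z : W.presheaf.stalk w ⧸ Ideal.span {g} => z ^ p ^ e) ''
                        (Ideal.span (Set.range t) : Set (W.presheaf.stalk w ⧸ Ideal.span {g})))) →
                      y ∈ Ideal.span (Set.range t)) ∧
              ∃ n : ℕ, ∀ m : ℕ, ringKrullDim (W.presheaf.stalk w) = m →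
                ∀ s : Fin m → W.presheaf.stalk w, (Ideal.span (Set.range s)).radical.IsMaximal →
                  ∀ y c : W.presheaf.stalk w, c ≠ 0 →
                    (∀ e : ℕ, c * y ^ p ^ e ∈
                      Ideal.span ((fun z : W.presheaf.stalk w => z ^ p ^ e) ''
                        (Ideal.span (Set.range s) : Set (W.presheaf.stalk w)))) →
                    g ^ n * y ∈ Ideal.span (Set.range s))) :=
  cover_of_hasResolution p k Y g (hasResolution_of_dim_le_one Y g hdim)

end Summit.ResolutionOfSingularities.ResolutionOfSingularities.Theorems.FRationalModification.Cover

end
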